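import Mathlib
import HarnessLib
import HarnessLib.Audit
import Summits.CriticalPhenomena.Statement
import Literature.Probability.Percolation.CardyFormula
import HarnessLib.Audit.Status.Attr

/-!
Route: CardyOrderDuality

DORMANT since 2026-08-24T22:59:18Z (reconciler: no traction for 7.1 d (last activity item-evidence-added at 2026-08-17T18:54:11Z); parked, not closed — `ledger route dormant route-CriticalPhenomena-CardyOrderDuality --off` to reactivate) — unstaffed, not closed; items shared with open routes are served there. `ledger route dormant <id> --off` reactivates.

# Route CardyOrderDuality — order plus duality — one-sided refinement dominance of Z2 crossing
probabilities gives scale covariance of sublimits and the unique limit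

It suffices to show X_OD = UniformRefinementDominance ("refinement never helps, asymptotically"):
for every conformal rectangle R and
ε > 0 there is δ₀ such that P^{δ'}(R) ≤ P^{δ}(R) + ε for all meshes 0 < δ' ≤ δ ≤ δ₀, P^δ(R) =
bondDomainCrossingProb R δ the P_{1/2}
bond-ℤ² crossing probability. This ONE-SIDED, signed inequality is what a sprinkled cross-scale
domination coupling would deliver (card
order-plus-duality-antichain, item S: SCSD with budget λ·w(δ) in Kesten's window, removed afterwards
by window continuity); it is
equivalent to LimitExists by a limsup/liminf argument (support UniformToLimit) and the conformal
step is delegated to the shared cruxes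
ConfInvTransport (CardyHarmonicInvariants r4) and CardyRigidity (CardyUniqueLimit r2). The route's
second, stand-alone deliverable
(tier 1) is where duality is load-bearing: the FIXED-RATIO one-sided inequality RefinementDominance
plus DualSum (self-duality survives
the discretisation) forces P^{δ/t}(R) − P^{δ}(R) → 0 for every R and t — scale covariance of every
subsequential limit — because duality
reverses the order and ℤ² at 1/2 is self-dual ("order plus duality is equality", card item O).
Lean: `∀ (R : Literature.Probability.RandomPlanarGeometry.ConformalRectangle) (ε : ℝ), 0 < ε → ∃ δ₀
: ℝ, 0 < δ₀ ∧ ∀ δ δ' : ℝ, 0 < δ' → δ' ≤ δ → δ ≤ δ₀ →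
Literature.Probability.Percolation.bondDomainCrossingProb R δ' ≤
Literature.Probability.Percolation.bondDomainCrossingProb R δ + ε`

## Assembly
Pure logic plus one choice function (checked to elaborate in the planner's Sketch.lean; proof
foreseen ≈ 100 lines): from
UniformRefinementDominance get LimitExists (UniformToLimit argument inlined); define f η := the
limit L_{R₀} of some conformal rectangle
R₀ admitting a uniformizing datum of cross-ratio η (Classical.choose; junk 0 if none); for any R
with datum (φ, x), η = crossRatio x,
ConfInvTransport R₀ → R (equal cross-ratios) transports L_{R₀} = f η to R, so ∀ R,
R.HasCrossingLimit (bondDomainCrossingProb R) f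
(= X_U of CardyUniqueLimit); CardyRigidity gives EqOn f cardyFunction (Ioo 0 1) and crossRatio x ∈
(0,1)
(ConformalRectangle.crossRatio_mem_Ioo_of_isUniformizing, proved), so the limit is cardyFunction
(crossRatio x): CardyFormulaZ2.
RefinementDominance, DualSum and the tier-1 supports are NOT hypotheses of the assembly: they are
the route's unconditional-value
deliverable (scale covariance of sublimits) and the finite-ratio rung towards
UniformRefinementDominance.

Rationale: WHY THIS LINE. Every route of the sub-problem needs LimitExists / scale covariance of subsequential
limits (CardyUniqueLimit r3, CardyRotToConf r3) and
none has a mechanism for it; SchrammSmirnov2011 (arXiv:1101.5820, p. 9 Question 2 and p. 11 Remark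
9) records uniqueness of the ℤ²
sublimits as open and points to a "renormalization theory approach". The card's observation is that
on the set Λ of subsequential limits
duality is an ORDER-REVERSING involution fixing every point (exact self-duality of bond-ℤ² at 1/2,
GrimmettPercolation1999 §11.2), so any
one-sided stochastic comparison between limits is an equality; hence only ONE SIGNED inequality
across scales has to be proved, and a
signed inequality with a positive, vanishing budget is exactly the type of statement sprinkling /
renormalisation technology produces
(GrimmettPercolation1999 §7.2 "spend a little extra money"; near-critical monotone families
arXiv:1305.5526, arXiv:0803.3785; window
continuity from KestenScalingCMP1987, Nolin2008, arXiv:2111.14414). Imported area: stochastic order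
/ coupling theory of monotone
percolation models (Strassen, LiggettSchonmannStacey1997) turned on the scale parameter; no
observable, no integrability, no conformal
input in the native cruxes. What it does that prior routes do not: it files the first typed
statements about the δ-dependence of ℤ²
crossing probabilities strictly between RSW and LimitExists (RefinementDominance, DualSum,
SublimitScaleCovariance) and a definite,
one-sided proof plan for LimitExists; the negatives index (one SAW item) is not touched.

RANKED CRUXES. #2 RefinementDominance (crux) — for every conformal rectangle R, every t ≥ 1 and ε >
0, eventually as δ → 0⁺: P^{δ/t}(R) ≤ P^{δ}(R) + ε — critical percolation at the finer mesh is
asymptotically dominated on the crossing event by the coarser mesh (card item S, SCSD(t), with the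
sprinkling budget already removed by window continuity; the intended proof spends λ·w(δ) at mesh δ
and lets λ ↓ 0 after δ → 0). [difficulty: XL] (why it might fail: With DualSum it is equivalent to
P(δ/t)−P(δ)→0: false iff crossings carry a non-constant log-periodic modulation
(logperiodic-limitexists-hunt). As PROOF target: cell-local cross-scale couplings decorrelate
crossings (noise sensitivity, arXiv:0803.3750 Prop 33); the domination must be non-local.)
[SchrammSmirnov2011, GrimmettPercolation1999, arXiv:1305.5526, arXiv:0803.3785,
GarbanPeteSchramm2010, LiggettSchonmannStacey1997, KestenScalingCMP1987, Ziff2011]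
#3 UniformRefinementDominance (crux) — X_OD: for every conformal rectangle R and ε > 0 there is δ₀ >
0 with P^{δ'}(R) ≤ P^{δ}(R) + ε whenever 0 < δ' ≤ δ ≤ δ₀ (uniform one-sided Cauchy criterion; card
item S "SCSD between arbitrary mesh pairs"). Equivalent per R to LimitExists (UniformToLimit and its
trivial converse); filed in the one-sided form a domination coupling delivers. [deps:
RefinementDominance] [difficulty: open-problem] (why it might fail: Per rectangle equivalent to
LimitExists (open: BollobasRiordan2006 Ch.7 Conj.1; SchrammSmirnov2011 Q2/Rem.9). A sprinkled
coupling must dominate across arbitrarily separated scales with ONE vanishing budget; iterating a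
fixed-ratio step k times spends k·λ (Grimmett1999 §7.2 'extra money').) [BollobasRiordan2006,
SchrammSmirnov2011, GrimmettPercolation1999, Nolin2008, arXiv:2111.14414, KestenScalingCMP1987]
#4 DualSum (crux) — self-duality survives the discretisation in the limit: for every conformal
rectangle R = (Ω; a, b, c, d), P_{1/2}[(ab)_δ ↔ (cd)_δ] + P_{1/2}[(bc)_δ ↔ (da)_δ] → 1 as δ → 0⁺
(both crossings of the SAME primal discrete domain Ω_δ, G02 discretisation). Card item O
bookkeeping: duality maps the crossing of R to the complementary crossing of the re-marked
rectangle, up to a (δ/2,δ/2) lattice shift and boundary effects. [difficulty: L] (why it might fail: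
Edge duality pairs (ab)↔(cd) on Ω_δ with a DUAL-lattice crossing (bc)*↔(da)* of a shifted discrete
domain; matching it to the primal (bc)↔(da) crossing at o(1) cost needs boundary 3-arm control along
∂Ω: routine for piecewise-smooth ∂Ω, unproved for wild Jordan curves (cf. stmt-0787/0748).)
[GrimmettPercolation1999, BollobasRiordan2006, SchrammSmirnov2011, Smirnov2001,
lean:Literature.Probability.Percolation.lrCrossing_xor_dualTBCrossing,
lean:Literature.Probability.Percolation.discreteCrossingProb_clusterPt_mem_Ioo]
#5 ConfInvTransport (crux) — (shared verbatim with CardyHarmonicInvariants r4,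
stmt-CriticalPhenomena-0794) conformal invariance of ℤ² crossing limits, transport form: two
conformal rectangles with uniformizing data of equal cross-ratio have the same limiting crossing
probability whenever one of them has a limit. The delegated conformal step of this route (card
assembly: "with DKKMO rotation invariance … the symmetry-upgrade routes"). [difficulty:
open-problem] (why it might fail: This IS conformal invariance of the ℤ² crossing limit
(Schramm2007ICM Problem 2.11): EmbeddingModulusUniqueness forbids every embedding-blind proof
(Beffara2008Universal Prop 4); needs DKKMO rotation invariance plus an upgrade theorem
(CardyRotToConf r2, open) or an exact ℤ² observable (none known).) [Schramm2007ICM,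
Beffara2008Universal, DKKMO2020Rotational, Smirnov2001,
lean:Literature.Barriers.CriticalPhenomena.EmbeddingModulusUniqueness]
#6 CardyRigidity (crux) — (shared verbatim with CardyUniqueLimit r2, stmt-CriticalPhenomena-0746)
Cardy rigidity on ℤ²: if the bond-ℤ² crossing probabilities of ALL conformal rectangles converge to
a function f of the cross-ratio, then f = cardyFunction on (0,1) (locality forces SLE₆; Schramm2000,
LawlerSchrammWerner2001, CamiaNewman2007). [difficulty: L] (why it might fail: False only if X_U
holds with f ≠ F (a conformally invariant non-Cardy ℤ² limit; arXiv:math/9401222 §3.2 numerics match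
F to 5e-3). As a THEOREM the hypothesis has fixed Jordan rectangles only, while CamiaNewman2007 Thm
2-3 need kernels in admissible non-Jordan domains and moving mesh.) [CamiaNewman2007, Schramm2000,
LawlerSchrammWerner2001, Werner2007, KemppainenSmirnov2017, arXiv:math/9401222]
#9 HalvingDominance (support) — the t = 2 special case of RefinementDominance (SCSD(2) shadow: one
step of 2×2 coarse-graining never helps asymptotically) — the cheapest meaningful sub-target and the
object of the cheapest falsifier; with DualSum it already gives P^{δ/2}(R) − P^{δ}(R) → 0 (dyadic
scale covariance of sublimits). [difficulty: XL] [GrimmettPercolation1999, SchrammSmirnov2011]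
#9 SublimitScaleCovariance (support) — tier-1 target (card consequence (2), "scale invariance from
half an inequality"): for every conformal rectangle R and t > 0, P^{δ/t}(R) − P^{δ}(R) → 0 as δ → 0⁺
— every subsequential limit of the crossing functional is invariant under mesh dilation by t
(equivalently, since P^{δ/t}(R) is the crossing probability of the dilated rectangle tR at mesh δ,
under domain dilations). Strictly weaker than LimitExists (slow log-log oscillations survive),
strictly stronger than RSW. [difficulty: XL] [SchrammSmirnov2011, arXiv:0803.3785,
DKKMO2020Rotational]
#9 TierOneGlue (support) — the order-plus-duality observation at the level of crossing functionals
(card item O, provable now): RefinementDominance → DualSum → SublimitScaleCovariance. Proof: for t ≥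
1 RefinementDominance for R gives limsup (P^{δ/t}(R) − P^{δ}(R)) ≤ 0; applied to the re-marked
rectangle R' = (Ω; b, c, d, a) (construct R' : ConformalRectangle with R'.carrier = R.carrier,
R'.arc 0 = R.arc 1, R'.arc 2 = R.arc 3 by shifting the boundary parametrisation — helper lemma) and
combined with DualSum along δ and δ/t it gives liminf ≥ 0; t < 1 by the substitution δ ↦ tδ.
[difficulty: provable-now] [SchrammSmirnov2011, arXiv:1305.5526]
#9 LimitExists (support) — (shared verbatim with CardyUniqueLimit r3, stmt-CriticalPhenomena-0747)
existence of the scaling limit of bond-ℤ² crossing probabilities at p = 1/2 for every conformal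
rectangle; the tier-2 target this route attacks through UniformRefinementDominance. [difficulty:
open-problem] [GrimmettPercolation1999, BollobasRiordan2006, SchrammSmirnov2011]
#9 UniformToLimit (support) — tier-2 glue (provable now): UniformRefinementDominance → LimitExists.
Proof: P^δ(R) ∈ [0,1]; fixing δ ≤ δ₀ and taking limsup over δ' → 0⁺ gives limsup P ≤ P^{δ}(R) + ε
for every δ ≤ δ₀, then liminf over δ: limsup ≤ liminf + ε; conclude with tendsto_of_liminf_eq_limsup
(bounded in [0,1]). No duality needed here (ℝ is totally ordered) — recorded honestly: duality is
load-bearing only in tier 1. [difficulty: provable-now] [SchrammSmirnov2011]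

TWO-LAYER PLAN. Foreseen glued splits (none filed now): RefinementDominance ⇐ HalvingDominance (t =
2) → TrisectionDominance (t = 3) → [density of
2^a3^b + continuity in t from RSW equicontinuity] → RefinementDominance; UniformRefinementDominance
⇐ SprinkledUniformDomination (with
Kesten's window w(δ), once the ℤ² four-arm / window API exists) → WindowContinuity (sup_δ
|P_{1/2+λw(δ)} − P_{1/2}| → 0 as λ → 0) →
UniformRefinementDominance; DualSum ⇐ DualSumSmooth (piecewise-C¹ ∂Ω, boundary 3-arm sum) →
JordanApproximation → DualSum.

KILL CRITERIA. ¬HalvingDominance or ¬RefinementDominance for one explicit conformal rectangle (a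
crossing probability with non-vanishing dyadic
increments) refutes RefinementDominance, UniformRefinementDominance, LimitExists AND CardyFormulaZ2
as typed at once: close
`refuted:RefinementDominance` and escalate (it kills every route of the sub-problem). ¬DualSum for a
WILD Jordan rectangle only: pivot —
restate DualSum / tier 1 for piecewise-smooth rectangles; ¬DualSum for a smooth rectangle signals a
discretisation pathology of
discreteCrossing (report to operator, cf. NegDegenerateArcs stmt-CriticalPhenomena-0748).
¬ConfInvTransport with LimitExists true =
a non-conformal ℤ² limit = ¬CardyFormulaZ2. LimitExists proved elsewhere moots
UniformRefinementDominance (tier 1 becomes a corollary)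
but not the assembly; X_U proved elsewhere moots everything but CardyRigidity.

NOT DECOMPOSED YET. The SPRINKLED forms proper (SCSD(t), SCSD_unif with budget λ·w(δ), w(δ) =
(δ⁻²α₄(δ,1))⁻¹) and window continuity (W): they need a bond-ℤ²
near-critical window / four-arm API (definition request below) and are the layer-2 children of ranks
2–3; the LAW-LEVEL dichotomy
"unique-or-antichain" and S_tΛ = Λ in Schramm–Smirnov's quad-crossing space (card item O; filed
informal after open, needs the space);
the total-order conjecture TO on near-critical sublimits (card item T: speculative umbrella,
deliberately unfiled — refuters may propose
¬TO); equicontinuity of P^δ(R) in the domain (needed only for law-level upgrades); which coupling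
realises the domination (exploration-
organised, interface-level, or a law-level renormalisation) — provers' business under rank 2.

CHEAPEST FALSIFIER. Monte-Carlo (union-find, duality control variate) of the dyadic increment Δ(δ) =
P^{δ/2}(R) − P^{δ}(R) for the 2:1 and 3:1 rectangles
(hard way) at δ = 1/64 … 1/2048: tier 1 predicts Δ → 0 (indeed Ziff1996 / card
monotone-approach-lyapunov numerics say Δ > 0 and
decaying like a power of δ, which also shows the ZERO-budget inequality is false at finite size —
the sprinkling budget is essential, as
the card says); a non-decaying |Δ| > 3σ across five octaves refutes HalvingDominance ∧ DualSum and
LimitExists with it. This is the dyadic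
slice of card logperiodic-limitexists-hunt; not run here (planner seat, no kit job) — refuters
first. Second cheapest: prove/try
TierOneGlue and UniformToLimit in Lean (provable now); a failure to close them as stated means the
route is mis-typed.

NUMBERS. P_{1/2}(LR crossing of the (n+1)×n box) = 1/2 exactly for all n (Literature
crossingProb_half_succ_self; GrimmettPercolation1999 Lemma
11.21); every cluster point of P^δ(R) lies in (0,1) for every conformal rectangle
(discreteCrossingProb_clusterPt_mem_Ioo, discharged
in BoxCrossingJordan.lean); target values F(η), F(1/2) = 1/2, F(η) + F(1−η) = 1 (consistent with
DualSum); ℤ² numerics agree with F to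
≈5·10⁻³ (arXiv:math/9401222 §3.2); half-plane 3-arm exponent 2 and α₄ > 1 on ℤ²
(GarbanPeteSchramm2010 / SchrammSmirnov2011 App.) are
the only exponent inputs foreseen (DualSum, window). Items at open: 11 typed (5 crux, 5 support, 1
assembly) + 1 informal support.

DEFINITION REQUESTS. (1) `QuadCrossingLimitLaws` (topic Literature/Probability/Percolation):
Schramm–Smirnov's compact quad-crossing space ℋ_D for bond-ℤ²
(arXiv:1101.5820 §1, Thm 1.4/Cor 1.8), laws of the mesh-δ configuration, the set Λ of weak
subsequential limits, the stochastic (FKG)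
order on laws generated by increasing finite-quad events, the duality involution D and dilations S_t
— needed to state the law-level
dichotomy UniqueOrAntichain (informal support item) and shared with cards
cle6-local-rigidity-connected-limits, scale-ergodic-quenched-
upgrade, monotone-approach-lyapunov (M5), canonical-gluing-comparison. (2) `zdNearCriticalWindow`
(topic Literature/Probability/
Percolation): bond-ℤ² alternating four-arm probability α₄(δ,1) / Kesten window w(δ) and the
near-critical family P_{1/2+λw(δ)} (the tree
has charLength/arm events for site-𝕋 only: KestenScaling.lean, ArmEvents.lean) — needed to file the
sprinkled forms SCSD(t)/SCSD_unif
and window continuity as layer-2 items.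

Novelty: Searches (2026-08-15): `lit frontier CriticalPhenomena --since 2020` (30 rows; only δ-dependence
item arXiv:2111.14414, near-critical
scaling relations); `lit bridges CriticalPhenomena --cross any` (nothing on cross-scale comparison);
`lit vsearch "<UniformRefinementDominance
in prose + self-duality/stochastic order>" -k 10` (10 textbook hits: Grimmett1999, Kesten1982,
BollobasRiordan-type — none states a
cross-mesh domination); `lit search --source crossref "renormalization stochastic domination
critical percolation two dimensions"` (10:
Nolin2008, Holroyd–Martin doi:10.1214/ejp.v19-2806 comb-percolation domination, RG physics 1978–83 —
none relevant); `lit search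
--source arxiv|openalex|s2` rate-limited (HTTP 429) and local searchd down (connection reset) all
session — recorded in NOTES; `lit read
arXiv:1101.5820` pp. 9–11 (Question 2, Remark 9: uniqueness of ℤ² sublimits open, "renormalization
theory approach"); ledger: the six
Theses files of the sub and the related cards monotone-approach-lyapunov,
logperiodic-limitexists-hunt, block-rg-noise-no-go,
cle6-local-rigidity-connected-limits, scale-ergodic-quenched-upgrade,
coherent-gluing-similarity-to-conformal (retired),
seam-pivotal-mass-no-go, canonical-gluing-comparison, squaring-covariance-cone-graph read; `lean
search` for quad-crossing / stochastic
domination decls (none) and near-critical ℤ² API (site-𝕋 only).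
Nearest prior art found: SchrammSmirnov2011 (arXiv:1101.5820: the arena, sublimits on ℤ², uniqueness
posed);  [refs: 10.1214/ejp.v19-2806, 2111.14414, 1101.5820, 1305.5526, 0803.3785, doi:10.1214/ejp.v19-2806, Grimmett1999, Kesten1982, Nolin2008, SchrammSmirnov2011, GrimmettPercolation1999, Ziff1996, Ziff2011]

Barriers (technique_class: stochastic-order self-duality sprinkling cross-scale): - technique_class: stochastic-order self-duality sprinkling cross-scale
- Literature.Barriers.CriticalPhenomena.EmbeddingModulusUniqueness: the native cruxes
(RefinementDominance, UniformRefinementDominance, DualSum, tier 1) are existence / scale-covariance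
statements, shear-covariant and true verbatim for a sheared self-dual lattice — the barrier's text
exempts them; the conformal content sits entirely in ConfInvTransport, which does NOT evade the
barrier and must import ℤ²-specific input (DKKMO2020Rotational + an upgrade, or an observable) —
conceded, delegated to the sibling routes that own it.
- Literature.Barriers.CriticalPhenomena.SprinklingRenormalisation: catalogued for
PercolationContinuityZ3 but its moral applies to the proof plan — block renormalisation certifies
only statements AFTER sprinkling η > 0; evasion: η = λ·w(δ) > 0 is spent inside the proof of the
one-sided inequality and removed afterwards by window continuity (λ ↓ 0 after δ → 0,
KestenScalingCMP1987 / arXiv:2111.14414), while the reverse inequality is paid by self-duality,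
never by a second renormalisation. Not catalogued but binding: card block-rg-noise-no-go (cell-local
cross-scale couplings decorrelate crossings, arXiv:0803.3750 Prop 33) — the domination coupling must
be non-local (exploration/interface-organised or law-level); the bet is that a MONOTONE one-sided
coupling with budget escapes the decorrelation that kills measure-preserving block maps.
- Literature.Barriers.CriticalPhenomena.SmirnovT

History (route lifecycle, newest last):
- 2026-08-15T16:18:04Z · rev 2: restated UniformToLimit (stmt-CriticalPhenomena-4720), Assembly (stmt-CriticalPhenomena-4721) — route-repair: un-block the two TODO items now that the shared decls CardyRigidity/LimitExists are in the module (rev 1). UniformToLimit (4720) is superseded by (planner-rbadge-CriticalPhenomena-CardyOrderDua-f45c4d48-g4-0)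
- 2026-08-24T22:59:18Z · DORMANT — reconciler: no traction for 7.1 d (last activity item-evidence-added at 2026-08-17T18:54:11Z); parked, not closed — `ledger route dormant route-CriticalPhenomen (operator:999:2611319)

sub-problem: CardyFormulaZ2 · status: dormant · opened planner-plancard-CriticalPhenomena-CardyFormu-a77f26e3-0 2026-08-15T11:34:52Z · rev 4 · ledger route-CriticalPhenomena-CardyOrderDuality
GENERATED by the gate from the ledger (D-0016/17). Provers cite these decls: `theorem foo : Summit.CriticalPhenomena.CardyFormulaZ2.Theses.CardyOrderDuality.<Decl> := …` in Summits/CriticalPhenomena/CardyFormulaZ2/Theorems/<Name>.lean.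
-/

namespace Summit.CriticalPhenomena.CardyFormulaZ2.Theses.CardyOrderDuality

open scoped BigOperators Topology Manifold Classical MeasureTheory ProbabilityTheory Matrix InnerProductSpace ComplexConjugate ContinuousMap
open Filter Set Function TopologicalSpace MeasureTheory

attribute [summit_statement] _root_.CardyFormulaZ2

/-- item stmt-CriticalPhenomena-4714 · crux · rank 2 · open · by planner
why it might fail: Zero-budget domination is false at finite size (Δ=P(δ/2)−P(δ)>0: Ziff1996/Ziff2011 numerics); with DualSum the ε-form ≡ t-adic scale covariance of ℤ² sublimits — open (arXiv:2012.11672 §1.1), false iff log-periodic modulation; cell-local couplings are clueless (arXiv:0803.3750 Prop 33).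
sources: arXiv:2012.11672 (DKKMO2020Rotational, p.3 §1.1: scale invariance is the other open step at q=1), arXiv:1101.5820 (SchrammSmirnov2011, p.9 Question 2, p.11 Remark 9), arXiv:0803.3750 (GarbanPeteSchramm2010, Prop 33 selective noise; p.36: convergence of E[f_RQ] not known in Z^2 even for rectangles), Ziff1996, Ziff2011, GrimmettPercolation1999 §7.2 (sprinkling)
[crux] for every conformal rectangle R, every t ≥ 1 and ε > 0, eventually as δ → 0⁺: P^{δ/t}(R) ≤
P^{δ}(R) + ε — critical percolation at the finer mesh is asymptotically dominated on the crossing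
event by the coarser mesh (card item S, SCSD(t), with the sprinkling budget already removed by
window continuity; the intended proof spends λ·w(δ) at mesh δ and lets λ ↓ 0 after δ → 0).
[difficulty: XL] -/
@[route_item "route-CriticalPhenomena-CardyOrderDuality"]
def RefinementDominance : Prop :=
  ∀ (R : Literature.Probability.RandomPlanarGeometry.ConformalRectangle) (t : ℝ), 1 ≤ t → ∀ ε : ℝ, 0 < ε → ∀ᶠ δ in nhdsWithin (0 : ℝ) (Set.Ioi 0), Literature.Probability.Percolation.bondDomainCrossingProb R (δ / t) ≤ Literature.Probability.Percolation.bondDomainCrossingProb R δ + ε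

/-- item stmt-CriticalPhenomena-4715 · crux · rank 3 · open · by planner
why it might fail: ≡ LimitExists per R — open (BollobasRiordan2006 p.159 Conj.1; Grimmett1999 §11.10; arXiv:1101.5820 Q2/Rem.9; arXiv:0803.3750 p.36). ONE vanishing budget must dominate across arbitrarily separated scales: k fixed-ratio steps cost k·λ; bond-ℤ² window continuity beyond Kesten unvendored.
sources: BollobasRiordan2006 (Ch.7 Conjecture 1, PDF p.159), GrimmettPercolation1999 (§11.10, p.346), arXiv:1101.5820 (SchrammSmirnov2011, Question 2 / Remark 9), arXiv:0803.3750 (GarbanPeteSchramm2010, p.36), KestenScalingCMP1987, Nolin2008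
[crux] X_OD: for every conformal rectangle R and ε > 0 there is δ₀ > 0 with P^{δ'}(R) ≤ P^{δ}(R) + ε
whenever 0 < δ' ≤ δ ≤ δ₀ (uniform one-sided Cauchy criterion; card item S "SCSD between arbitrary
mesh pairs"). Equivalent per R to LimitExists (UniformToLimit and its trivial converse); filed in
the one-sided form a domination coupling delivers. [deps: RefinementDominance] [difficulty:
open-problem] -/
@[route_item "route-CriticalPhenomena-CardyOrderDuality", crux]
def UniformRefinementDominance : Prop :=
  ∀ (R : Literature.Probability.RandomPlanarGeometry.ConformalRectangle) (ε : ℝ), 0 < ε → ∃ δ₀ : ℝ, 0 < δ₀ ∧ ∀ δ δ' : ℝ, 0 < δ' → δ' ≤ δ → δ ≤ δ₀ → Literature.Probability.Percolation.bondDomainCrossingProb R δ' ≤ Literature.Probability.Percolation.bondDomainCrossingProb R δ + ε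

/-- item stmt-CriticalPhenomena-4716 · crux · rank 4 · closed · proved by Summit.CriticalPhenomena.CardyFormulaZ2.Theorems.dualSum_proof @ 0efa074c7b39 (prover) · by planner
why it might fail: Exact duality pairs (ab)↔(cd) in Ω_δ with a crossing of the (δ/2,δ/2)-shifted DUAL domain, not with (bc)↔(da) of the same Ω_δ; the o(1) matching needs half-plane 3-arm boundary control, standard only for piecewise-smooth ∂Ω (arXiv:1008.1378 §2.1) — unproved for wild Jordan ∂Ω (cf. stmt-0748).
sources: GrimmettPercolation1999 (§11.2, Lemma 11.21), BollobasRiordan2006 (Ch.3 Lemma 1), arXiv:1008.1378 (GarbanPeteSchramm2013 Pivotal, p.4 §2.1: quads have piecewise-smooth boundary; p.14: half-plane 3-arm control at smooth boundary pieces; p.33: h.p. 3-arm exponent 2 also known on Z^2), Smirnov2001 (§2 discretisation), lean:Literature.Probability.Percolation.lrCrossing_xor_dualTBCrossing, lean:Literature.Probability.Percolation.bondPercolation_map_dualConfig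
[crux] self-duality survives the discretisation in the limit: for every conformal rectangle R = (Ω;
a, b, c, d), P_{1/2}[(ab)_δ ↔ (cd)_δ] + P_{1/2}[(bc)_δ ↔ (da)_δ] → 1 as δ → 0⁺ (both crossings of
the SAME primal discrete domain Ω_δ, G02 discretisation). Card item O bookkeeping: duality maps the
crossing of R to the complementary crossing of the re-marked rectangle, up to a (δ/2,δ/2) lattice
shift and boundary effects. [difficulty: L] -/
@[route_item "route-CriticalPhenomena-CardyOrderDuality"]
def DualSum : Prop :=
  ∀ R : Literature.Probability.RandomPlanarGeometry.ConformalRectangle, Filter.Tendsto (fun δ : ℝ => Literature.Probability.Percolation.bondDomainCrossingProb R δ + Literature.Probability.Percolation.discreteCrossingProb Literature.Probability.Percolation.half R.carrier δ (R.arc 1) (R.arc 3)) (nhdsWithin (0 : ℝ) (Set.Ioi 0)) (nhds 1)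

/-- item stmt-CriticalPhenomena-0794 · crux · rank 5 · open · by planner
why it might fail: It IS conformal invariance of the ℤ² crossing limit (Schramm2007ICM Problem 2.11; BollobasRiordan2006 Ch.7 Conj.1): EmbeddingModulusUniqueness forbids embedding-blind proofs (Beffara2008Universal Prop 4); needs DKKMO rotation invariance + an upgrade theorem (open) or a ℤ² observable (none known).
sources: Schramm2007ICM (§2.6 Problem 2.11), BollobasRiordan2006 (Ch.7 Conjecture 1, PDF p.159), Beffara2008Universal (arXiv:0708.3908, Prop 4 p.6: zero or two moduli give conformal invariance), DKKMO2020Rotational (arXiv:2012.11672, §1.1), Smirnov2001 (Thm 1, triangular case; closing remark: Z^2 bond open), lean:Literature.Barriers.CriticalPhenomena.EmbeddingModulusUniqueness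
[crux] Conformal invariance of crossing limits on Z^2, transport form: two conformal rectangles with
uniformizing data of equal cross-ratio have the same limiting crossing probability whenever one of
them has a limit (Z^2 analogue of Literature tendsto_triDomainCrossingProb_of_crossRatio_eq).
Consequence of X_H; open. -/
@[route_item "route-CriticalPhenomena-CardyOrderDuality", crux]
def ConfInvTransport : Prop :=
  ∀ (R R' : Literature.Probability.RandomPlanarGeometry.ConformalRectangle) (φ : Literature.Probability.RandomPlanarGeometry.ConformalEquiv UpperHalfPlane.upperHalfPlaneSet R.carrier) (x : Fin 4 → ℝ) (φ' : Literature.Probability.RandomPlanarGeometry.ConformalEquiv UpperHalfPlane.upperHalfPlaneSet R'.carrier) (x' : Fin 4 → ℝ), R.IsUniformizing φ x → R'.IsUniformizing φ' x' → Literature.Probability.RandomPlanarGeometry.crossRatio x = Literature.Probability.RandomPlanarGeometry.crossRatio x' → ∀ L : ℝ, Filter.Tendsto (Literature.Probability.Percolation.bondDomainCrossingProb R) (nhdsWithin 0 (Set.Ioi 0)) (nhds L) → Filter.Tendsto (Literature.Probability.Percolation.bondDomainCrossingProb R') (nhdsWithin 0 (Set.Ioi 0)) (nhds L)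

/-- item stmt-CriticalPhenomena-0746 · crux · rank 6 · open · by planner
why it might fail: False only if X_U holds with f ≠ F (a conformally invariant non-Cardy ℤ² limit; arXiv:math/9401222 §3.2 numerics match F to 5e-3). As a THEOREM the hypothesis has fixed Jordan rectangles only, while CamiaNewman2007 Thm 2-3 need kernels in admissible non-Jordan domains and moving mesh.
sources: doi:10.1007/s00440-006-0049-7 (CamiaNewman2007, Thm 2 p486, Thm 3 pp488-489), arXiv:math/9904022 (Schramm2000, §1.5), arXiv:math/9911084 (LawlerSchrammWerner2001, §2-3), arXiv:0710.0856 (Werner2007, §3), arXiv:1212.6215 (KemppainenSmirnov2017, Thm 1.3), arXiv:math/9401222 (LPSA1994, §3.2)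
[crux] Cardy rigidity on Z^2: if the bond-Z^2 crossing probabilities of ALL conformal rectangles
converge to a function f of the cross-ratio, then f = cardyFunction on (0,1). Intended proof: with f
as hitting kernel, Smirnov2001 Thm 2 / CamiaNewman2007 §§5-7 / Werner2007 §4 give convergence of the
exploration path (AB tightness isTightLaws_map_bondInterface, RSW rsw_half) to a conformally
invariant domain-Markov curve = SLE_κ (Schramm2000); percolation locality forces κ = 6
(LawlerSchrammWerner2001 §3, cf. eq_six_of_forall_measureReal_hitsBefore) and
sle_six_measureReal_hitsBefore returns f = F. Vacuous unless X_U holds, but provable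
unconditionally. -/
@[route_item "route-CriticalPhenomena-CardyOrderDuality", crux]
def CardyRigidity : Prop :=
  ∀ f : ℝ → ℝ, (∀ R : Literature.Probability.RandomPlanarGeometry.ConformalRectangle, R.HasCrossingLimit (Literature.Probability.Percolation.bondDomainCrossingProb R) f) → Set.EqOn f Literature.Probability.RandomPlanarGeometry.cardyFunction (Set.Ioo 0 1)

/-- item stmt-CriticalPhenomena-0747 · support · rank 9 · open · by planner
sources: GrimmettPercolation1999 §11.10, BollobasRiordan2006 Ch.7 Conjecture 1, arXiv:1101.5820 (SchrammSmirnov2011, Question 2 / Remark 9), lean:Literature.Probability.Percolation.discreteCrossingProb_clusterPt_mem_Ioo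
[crux] Existence of the scaling limit of bond-Z^2 crossing probabilities at p=1/2 for every
conformal rectangle (no identification, no conformal invariance). Open (Grimmett1999 §9.7
conjecture; only RSW bounds on cluster points are known: discreteCrossingProb_clusterPt_mem_Ioo).
Necessary for the conjunct. -/
@[route_item "route-CriticalPhenomena-CardyOrderDuality"]
def LimitExists : Prop :=
  ∀ R : Literature.Probability.RandomPlanarGeometry.ConformalRectangle, ∃ L : ℝ, Filter.Tendsto (Literature.Probability.Percolation.bondDomainCrossingProb R) (nhdsWithin 0 (Set.Ioi 0)) (nhds L)

/-- item stmt-CriticalPhenomena-10539 · support · rank 9 · open · by planner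
sources: SchrammSmirnov2011
[support] tier-2 glue, now stated as the EQUIVALENCE X_OD ⟺ LimitExists (provable now; supersedes
UniformToLimit = the → half, whose candidate proof is attached to stmt-CriticalPhenomena-4720): → is
the liminf/limsup argument (P^δ(R) ∈ [0,1]; L := liminf; X_OD at ε/2 and a δ ∈ (0,δ₀] with P^δ(R) <
L + ε/2 give limsup ≤ L + ε; tendsto_of_le_liminf_of_limsup_le) and is inlined in the deciding
theorem `closes`; ← is the Cauchy criterion (Metric.tendsto_nhds + mem_nhdsGT_iff_exists_Ioo_subset,
δ₀ := δ₁/2). Both directions checked sorry-free in the planner's Sketch.lean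
(uniformIffLimit_holds). Honest bookkeeping: the one-sided form adds no falsifiable content beyond
LimitExists; the route's native content is HOW X_OD is to be proved (sprinkled cross-scale
domination, ranks 2–3). [difficulty: provable-now] -/
@[route_item "route-CriticalPhenomena-CardyOrderDuality"]
def UniformIffLimit : Prop :=
  UniformRefinementDominance ↔ LimitExists

/-- item stmt-CriticalPhenomena-4717 · support · rank 9 · open · by planner
sources: GrimmettPercolation1999, SchrammSmirnov2011
[support] the t = 2 special case of RefinementDominance (SCSD(2) shadow: one step of 2×2
coarse-graining never helps asymptotically) — the cheapest meaningful sub-target and the object of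
the cheapest falsifier; with DualSum it already gives P^{δ/2}(R) − P^{δ}(R) → 0 (dyadic scale
covariance of sublimits). [difficulty: XL] -/
@[route_item "route-CriticalPhenomena-CardyOrderDuality"]
def HalvingDominance : Prop :=
  ∀ (R : Literature.Probability.RandomPlanarGeometry.ConformalRectangle) (ε : ℝ), 0 < ε → ∀ᶠ δ in nhdsWithin (0 : ℝ) (Set.Ioi 0), Literature.Probability.Percolation.bondDomainCrossingProb R (δ / 2) ≤ Literature.Probability.Percolation.bondDomainCrossingProb R δ + ε

/-- item stmt-CriticalPhenomena-4718 · support · rank 9 · open · by planner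
sources: SchrammSmirnov2011, arXiv:0803.3785, DKKMO2020Rotational
[support] tier-1 target (card consequence (2), "scale invariance from half an inequality"): for
every conformal rectangle R and t > 0, P^{δ/t}(R) − P^{δ}(R) → 0 as δ → 0⁺ — every subsequential
limit of the crossing functional is invariant under mesh dilation by t (equivalently, since
P^{δ/t}(R) is the crossing probability of the dilated rectangle tR at mesh δ, under domain
dilations). Strictly weaker than LimitExists (slow log-log oscillations survive), strictly stronger
than RSW. [difficulty: XL] -/
@[route_item "route-CriticalPhenomena-CardyOrderDuality"]
def SublimitScaleCovariance : Prop :=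
  ∀ (R : Literature.Probability.RandomPlanarGeometry.ConformalRectangle) (t : ℝ), 0 < t → Filter.Tendsto (fun δ : ℝ => Literature.Probability.Percolation.bondDomainCrossingProb R (δ / t) - Literature.Probability.Percolation.bondDomainCrossingProb R δ) (nhdsWithin (0 : ℝ) (Set.Ioi 0)) (nhds 0)

/-- item stmt-CriticalPhenomena-4719 · support · rank 9 · open · by planner
sources: SchrammSmirnov2011, arXiv:1305.5526
[support] the order-plus-duality observation at the level of crossing functionals (card item O,
provable now): RefinementDominance → DualSum → SublimitScaleCovariance. Proof: for t ≥ 1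
RefinementDominance for R gives limsup (P^{δ/t}(R) − P^{δ}(R)) ≤ 0; applied to the re-marked
rectangle R' = (Ω; b, c, d, a) (construct R' : ConformalRectangle with R'.carrier = R.carrier,
R'.arc 0 = R.arc 1, R'.arc 2 = R.arc 3 by shifting the boundary parametrisation — helper lemma) and
combined with DualSum along δ and δ/t it gives liminf ≥ 0; t < 1 by the substitution δ ↦ tδ.
[difficulty: provable-now] -/
@[route_item "route-CriticalPhenomena-CardyOrderDuality"]
def TierOneGlue : Prop :=
  RefinementDominance → DualSum → SublimitScaleCovariance

-- item stmt-CriticalPhenomena-4955 · support · rank 9 · open · by planner — informal only, no Lean statement yet: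
--   [support] Law-level dichotomy "unique-or-antichain" (card order-plus-duality-antichain, item O;
--   provable once the notion QuadCrossingLimitLaws exists): in Schramm–Smirnov's compact quad-crossing
--   space H for bond-Z^2 at p = 1/2 (arXiv:1101.5820 Thm 1.4 / Cor 1.8: weak subsequential limits
--   exist), let Lambda be the set of subsequential limits as delta -> 0+, <= the stochastic order on
--   laws generated by increasing finite-quad events (a determining pi-system, so <= is antisymmetric), D
--   the duality involution (Q is D-crossed iff the dual quad is not crossed; boundary events are null by
--   RSW). Then (

-- earlier Assembly (stmt-CriticalPhenomena-4721, replaced 2026-08-15T16:18:04Z -> stmt-CriticalPhenomena-10540): retired by None — UniformRefinementDominance → ConfInvTransport → CardyRigidity → CardyFormulaZ2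
/-- item stmt-CriticalPhenomena-10540 · assembly · rank 1 · open · by planner
sources: Smirnov2001, CamiaNewman2007, SchrammSmirnov2011
[assembly] UniformRefinementDominance → ConfInvTransport → CardyRigidity → CardyFormulaZ2 —
literally the deciding theorem `closes` of this route (planner glue, sorry-free, axioms
propext/Classical.choice/Quot.sound): X_OD ⇒ LimitExists (→ of UniformIffLimit, inlined) ⇒ with
ConfInvTransport, f η := limit of a chosen rectangle with a uniformizing datum of cross-ratio η
(dite, junk 0) gives X_U ⇒ CardyRigidity ⇒ EqOn f F (Ioo 0 1) ∋ crossRatio x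
(ConformalRectangle.crossRatio_mem_Ioo_of_isUniformizing) ⇒ CardyFormulaZ2. A prover closes it in
one line: `theorem assembly_holds : Assembly := closes`. -/
@[route_item "route-CriticalPhenomena-CardyOrderDuality"]
def Assembly : Prop :=
  UniformRefinementDominance → ConfInvTransport → CardyRigidity → _root_.CardyFormulaZ2

-- records of items no longer active in this route (dropped / restated):
-- earlier UniformToLimit (stmt-CriticalPhenomena-4720, replaced 2026-08-15T16:18:04Z -> stmt-CriticalPhenomena-10539): retired by None — UniformRefinementDominance → LimitExists

/-! D-0027 §2.1 — DECIDING THEOREM (planner-authored via `route open/edit --closes-file`; by planner-rbadge-CriticalPhenomena-CardyOrderDua-f45c4d48-g4-0 2026-08-15T16:19:43Z):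
its hypotheses are this route's items and its conclusion the sub-problem Statement (glue_lint), and it elaborates with this file. -/

@[closes "route-CriticalPhenomena-CardyOrderDuality"] theorem closes (hU : UniformRefinementDominance) (hT : ConfInvTransport) (hR : CardyRigidity) :
    _root_.CardyFormulaZ2 := by
  -- D-0027 §2.1 deciding theorem. Tier-2 glue (the support item UniformToLimit, inlined): the
  -- one-sided uniform Cauchy criterion X_OD forces limsup ≤ liminf for the [0,1]-valued crossing
  -- probability of every conformal rectangle, so the scaling limit exists (LimitExists).
  have hlim : ∀ R : Literature.Probability.RandomPlanarGeometry.ConformalRectangle, ∃ L : ℝ,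
      Tendsto (Literature.Probability.Percolation.bondDomainCrossingProb R) (𝓝[>] 0) (𝓝 L) := by
    intro R
    have h01 : ∀ δ : ℝ,
        Literature.Probability.Percolation.bondDomainCrossingProb R δ ∈ Icc (0:ℝ) 1 :=
      fun δ => Literature.Probability.Percolation.bondDomainCrossingProb_mem_Icc R δ
    have hble : IsBoundedUnder (· ≤ ·) (𝓝[>] (0:ℝ))
        (Literature.Probability.Percolation.bondDomainCrossingProb R) :=
      isBoundedUnder_of ⟨1, fun δ => (h01 δ).2⟩
    have hbge : IsBoundedUnder (· ≥ ·) (𝓝[>] (0:ℝ))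
        (Literature.Probability.Percolation.bondDomainCrossingProb R) :=
      isBoundedUnder_of ⟨0, fun δ => (h01 δ).1⟩
    have hcle : IsCoboundedUnder (· ≤ ·) (𝓝[>] (0:ℝ))
        (Literature.Probability.Percolation.bondDomainCrossingProb R) := hbge.isCoboundedUnder_le
    have hcge : IsCoboundedUnder (· ≥ ·) (𝓝[>] (0:ℝ))
        (Literature.Probability.Percolation.bondDomainCrossingProb R) := hble.isCoboundedUnder_ge
    refine ⟨liminf (Literature.Probability.Percolation.bondDomainCrossingProb R) (𝓝[>] 0),
      tendsto_of_le_liminf_of_limsup_le le_rfl ?_ hble hbge⟩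
    refine le_of_forall_pos_le_add fun ε hε => ?_
    obtain ⟨δ₀, hδ₀, hdom⟩ := hU R (ε / 2) (half_pos hε)
    have hfreq : ∃ᶠ δ in 𝓝[>] (0:ℝ), Literature.Probability.Percolation.bondDomainCrossingProb R δ <
        liminf (Literature.Probability.Percolation.bondDomainCrossingProb R) (𝓝[>] 0) + ε / 2 :=
      frequently_lt_of_liminf_lt hcge (by linarith)
    have hev : ∀ᶠ δ in 𝓝[>] (0:ℝ), δ ∈ Ioc (0:ℝ) δ₀ := Ioc_mem_nhdsGT hδ₀
    obtain ⟨δ, hpδ, hδpos, hδle⟩ := (hfreq.and_eventually hev).exists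
    refine limsup_le_of_le hcle ?_
    filter_upwards [Ioc_mem_nhdsGT hδpos] with δ' hδ'
    have h1 := hdom δ δ' hδ'.1 hδ'.2 hδle
    linarith
  -- The would-be conformally invariant limit as a function of the cross-ratio: f η := the limit of
  -- SOME conformal rectangle admitting a uniformizing datum of cross-ratio η (junk 0 if none).
  choose Lim hLim using hlim
  obtain ⟨f, hfdef⟩ : ∃ f : ℝ → ℝ, ∀ η : ℝ, f η =
      if h : ∃ R : Literature.Probability.RandomPlanarGeometry.ConformalRectangle,
          ∃ φ : Literature.Probability.RandomPlanarGeometry.ConformalEquiv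
            UpperHalfPlane.upperHalfPlaneSet R.carrier,
          ∃ x : Fin 4 → ℝ, R.IsUniformizing φ x ∧
            Literature.Probability.RandomPlanarGeometry.crossRatio x = η
      then Lim h.choose else 0 :=
    ⟨_, fun η => rfl⟩
  -- ConfInvTransport carries the limit of the chosen rectangle to every rectangle with a datum of
  -- the same cross-ratio: X_U (CardyUniqueLimit's thesis) holds with this f.
  have hXU : ∀ R : Literature.Probability.RandomPlanarGeometry.ConformalRectangle,
      R.HasCrossingLimit (Literature.Probability.Percolation.bondDomainCrossingProb R) f := by
    intro R φ x hux
    have hex : ∃ R' : Literature.Probability.RandomPlanarGeometry.ConformalRectangle,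
        ∃ φ' : Literature.Probability.RandomPlanarGeometry.ConformalEquiv
          UpperHalfPlane.upperHalfPlaneSet R'.carrier,
        ∃ x' : Fin 4 → ℝ, R'.IsUniformizing φ' x' ∧
          Literature.Probability.RandomPlanarGeometry.crossRatio x' =
            Literature.Probability.RandomPlanarGeometry.crossRatio x :=
      ⟨R, φ, x, hux, rfl⟩
    obtain ⟨φ₀, x₀, h₀, hη₀⟩ := hex.choose_spec
    rw [hfdef, dif_pos hex]
    exact hT hex.choose R φ₀ x₀ φ x h₀ hux hη₀ (Lim hex.choose) (hLim hex.choose)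
  -- Cardy rigidity identifies f with Cardy's function on (0,1), where every cross-ratio of a
  -- uniformizing datum lives (ConformalRectangle.crossRatio_mem_Ioo_of_isUniformizing, proved).
  have hEq : Set.EqOn f Literature.Probability.RandomPlanarGeometry.cardyFunction (Set.Ioo 0 1) :=
    hR f hXU
  intro R φ x hux
  rw [← hEq (Literature.Probability.RandomPlanarGeometry.ConformalRectangle.crossRatio_mem_Ioo_of_isUniformizing hux)]
  exact hXU R φ x hux

end Summit.CriticalPhenomena.CardyFormulaZ2.Theses.CardyOrderDuality
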